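import Literature.Analysis.FluidPDE.LinearisedNSFourierTimeRegularity
import Literature.Analysis.FluidPDE.CorrectorFourierSynthesis
import Literature.Analysis.FunctionSpaces.TorusInverseLaplacianL2
import HarnessLib

/-!
# Fourier-side data of the linearised Navier–Stokes equation for a smooth background and datum

Analysis/FluidPDE proof file, sixth of the files `LinearisedNSFourier*` (objects in
`LinearisedNSFourierDefs`; the Picard limit and its time regularity in
`LinearisedNSFourierIteration`, `LinearisedNSFourierTimeRegularity`). For a background velocity
`u` jointly smooth and divergence free on `[0, T] × T^d` and a smooth, divergence-free,
mean-zero datum `w₀` (Constantin–Foias 1988, Ch. 14, (14.3): the linearised equation in `H`),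
the Fourier-side data `U = CorrectorFourier.driftCoeff T u` (reused from the Cheskidov–Luo
construction, `CorrectorFourierData`) and `a = datumCoeff w₀` satisfy:

* `exists_hasDecay_datumCoeff`, `sum_intCast_mul_datumCoeff`, `datumCoeff_zero` — every decay
  of the datum coefficients, their Fourier divergence freedom `∑ₗ kₗ aₗ(k) = 0` (from
  `div w₀ = 0`, `CorrectorFourier.sum_intCast_mul_mFourierCoeff_eq_zero`) and the vanishing of
  the zero mode `aₗ(0) = ∫ w₀ₗ = 0` (from `∫ w₀ = 0`);
* `picardHyp` — the hypotheses `PicardHyp ν T U a` of the Picard iteration (`ν > 0`, `T > 0`);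
* `solCoeff_spec` — the package of Fourier-side properties of the solution coefficients
  `c = solCoeff ν T u w₀` (continuity, every decay, divergence freedom, zero mode, the datum,
  the differentiated mild equation on `[0, T]`, coefficient families of every order);
* `exists_presFamily` — the pressure coefficients `presCoeffField ν T u w₀` start a coefficient
  family of every order (as `CorrectorFourier.exists_presFamily`).

## References

* P. Constantin, C. Foias, *Navier–Stokes Equations*, Univ. Chicago Press 1988, Ch. 14, (14.3). [`ConstantinFoiasNSE1988`]
* L. Grafakos, *Classical Fourier Analysis*, 3rd ed. (2014), Prop. 3.2.6 (8), §3.3.1. [`Grafakos2014`]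
-/

noncomputable section

open MeasureTheory Real Set Filter Topology UnitAddTorus

namespace Literature.Analysis.FluidPDE

namespace LinearisedNSFourier

open ScalarFourier
open CorrectorFourier (leraySym compC driftFam driftCoeff isCoeffFamily_driftFam driftFam_zero_of_mem
  sum_intCast_mul_driftCoeff norm_presSymbol_le norm_intCast_apply_le)
open FourierNS (HasDecay clamp)
open Literature.Analysis.FunctionSpaces.Torus (freqNormSq IsSmoothSpaceTimeOn IsSmooth)

variable {d : Type*} [Fintype d] [DecidableEq d]
variable {ν T : ℝ} {u : ℝ → UnitAddTorus d → EuclideanSpace ℝ d}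
  {w₀ : UnitAddTorus d → EuclideanSpace ℝ d}

/-! ### The datum -/

omit [DecidableEq d] in
/-- The complexified components of a smooth datum are smooth. [folklore] -/
theorem isSmooth_datumComp (hw₀ : IsSmooth w₀) (l : d) : IsSmooth (fun x => ((w₀ x l : ℝ) : ℂ)) :=
  (hw₀.apply l).comp_clm Complex.ofRealCLM

/-- **Every polynomial decay of the datum coefficients**, uniformly in the component
(`ScalarFourier.exists_hasDecay_mFourierCoeff`; Grafakos 2014, §3.3.1). [folklore] -/
theorem exists_hasDecay_datumCoeff (hw₀ : IsSmooth w₀) (K : ℕ) :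
    ∃ A₀ : ℝ, 0 ≤ A₀ ∧ ∀ l, HasDecay K A₀ (datumCoeff w₀ l) := by
  have h1 : ∀ l : d, ∃ C : ℝ, 0 ≤ C ∧ HasDecay K C (datumCoeff w₀ l) := fun l =>
    exists_hasDecay_mFourierCoeff (isSmooth_datumComp hw₀ l) K
  choose C hC0 hC using h1
  exact ⟨∑ l, C l, Finset.sum_nonneg fun l _ => hC0 l,
    fun l => (hC l).mono (Finset.single_le_sum (fun i _ => hC0 i) (Finset.mem_univ l))⟩

/-- **Fourier-side divergence freedom of the datum**: `∑ₗ kₗ aₗ(k) = 0` for a smooth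
divergence-free `w₀` (`𝓕(div w₀) = 2πi ∑ₗ kₗ 𝓕(w₀ₗ) = 0`). [folklore] -/
theorem sum_intCast_mul_datumCoeff (hw₀ : IsSmooth w₀) (hdiv : FunctionSpaces.Torus.IsDivFree w₀)
    (k : d → ℤ) : ∑ l, (k l : ℂ) * datumCoeff w₀ l k = 0 :=
  CorrectorFourier.sum_intCast_mul_mFourierCoeff_eq_zero hw₀ hdiv k

omit [DecidableEq d] in
/-- **The zero mode of the datum vanishes** for a mean-zero `w₀`: `aₗ(0) = ∫ w₀ₗ = (∫ w₀)ₗ = 0`. [folklore] -/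
theorem datumCoeff_zero (hw₀ : IsSmooth w₀) (hmean : FunctionSpaces.Torus.HasZeroMean w₀) (l : d) :
    datumCoeff w₀ l 0 = 0 := by
  rw [datumCoeff_apply, FunctionSpaces.Torus.mFourierCoeff_zero_eq_integral, integral_complex_ofReal,
    Complex.ofReal_eq_zero]
  have hint : Integrable w₀ volume := hw₀.integrable
  have h1 : ∫ x, w₀ x l = (∫ x, w₀ x) l := by
    rw [show (∫ x, w₀ x) l = (EuclideanSpace.proj l : EuclideanSpace ℝ d →L[ℝ] ℝ) (∫ x, w₀ x) from rfl,
      ← ContinuousLinearMap.integral_comp_comm _ hint]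
    rfl
  rw [h1]
  have h0 : ∫ x, w₀ x = 0 := hmean
  rw [h0]
  rfl

/-! ### The Picard hypotheses -/

/-- **The Fourier-side data of a smooth background and datum satisfy `PicardHyp`** for
`ν > 0`, `T > 0`: continuity in time of the drift coefficients at each frequency (the zeroth
members of the drift families are continuous on `[0, T]`, composed with the continuous clamp),
every decay uniformly in time (uniform on the compact `[0, T]`), exactly as
`CorrectorFourier.dataHyp`; every decay of the datum coefficients. [folklore] -/
theorem picardHyp (hν : 0 < ν) (hT : 0 < T) (hu : IsSmoothSpaceTimeOn (Icc 0 T) u) (hw₀ : IsSmooth w₀) :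
    PicardHyp ν T (driftCoeff T u) (datumCoeff w₀) := by
  have hUFf : ∀ n j, IsCoeffFamily T n (driftFam T u j) := isCoeffFamily_driftFam hT hu
  refine ⟨hν, hT, fun j m => ?_, fun K => ?_, fun K => ?_⟩
  · exact ((hUFf 0 j).cont 0 le_rfl m).comp_continuous (FourierNS.continuous_clamp T)
      fun t => FourierNS.clamp_mem_Icc hT.le t
  · have h1 : ∀ j, ∃ C : ℝ, 0 ≤ C ∧ ∀ t ∈ Icc 0 T, HasDecay K C (driftFam T u j 0 t) := fun j =>
      (hUFf 0 j).decay_nonneg le_rfl K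
    choose C hC0 hC using h1
    refine ⟨∑ j, C j, fun j t => ((hC j _ (FourierNS.clamp_mem_Icc hT.le t)).mono ?_)⟩
    exact Finset.single_le_sum (fun i _ => hC0 i) (Finset.mem_univ j)
  · obtain ⟨A₀, -, hA₀⟩ := exists_hasDecay_datumCoeff hw₀ K
    exact ⟨A₀, hA₀⟩

/-! ### The Fourier-side package of the solution coefficients -/

/-- **The Fourier-side properties of `c = solCoeff ν T u w₀`** for `ν > 0`, `T > 0`, a jointly
smooth divergence-free background `u` on `[0, T] × T^d` and a smooth divergence-free mean-zero
datum `w₀`: continuity in time, every decay uniformly in time, Fourier divergence freedom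
`∑ₗ kₗ c(l,t,k) = 0`, vanishing zero mode `c(l,t,0) = 0`, the datum `c(l,0,k) = aₗ(k)`, the
differentiated mild equation `∂ₜcₗ = -νₖcₗ - (P linSym)ₗ` within `[0, T]`, and coefficient
families of every order starting at `c` (collected from `LinearisedNSFourierIteration`,
`LinearisedNSFourierTimeRegularity`). [folklore] -/
theorem solCoeff_spec (hν : 0 < ν) (hT : 0 < T) (hu : IsSmoothSpaceTimeOn (Icc 0 T) u)
    (hdiv : ∀ t ∈ Icc 0 T, FunctionSpaces.Torus.IsDivFree (u t)) (hw₀ : IsSmooth w₀)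
    (hw₀div : FunctionSpaces.Torus.IsDivFree w₀) (hw₀mean : FunctionSpaces.Torus.HasZeroMean w₀) :
    (∀ l m, Continuous fun t => solCoeff ν T u w₀ l t m) ∧
    (∀ K : ℕ, ∃ C : ℝ, 0 ≤ C ∧ ∀ l t, HasDecay K C (solCoeff ν T u w₀ l t)) ∧
    (∀ t k, ∑ l, (k l : ℂ) * solCoeff ν T u w₀ l t k = 0) ∧
    (∀ l t, solCoeff ν T u w₀ l t 0 = 0) ∧
    (∀ l k, solCoeff ν T u w₀ l 0 k = datumCoeff w₀ l k) ∧
    (∀ l k, ∀ t ∈ Icc 0 T, HasDerivWithinAt (fun s => solCoeff ν T u w₀ l s k)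
      (-(heatRate ν k : ℂ) * solCoeff ν T u w₀ l t k -
        linProjSym (fun j => driftCoeff T u j t) (fun j => solCoeff ν T u w₀ j t) l k) (Icc 0 T) t) ∧
    (∀ n : ℕ, ∃ W : d → ℕ → ℝ → (d → ℤ) → ℂ, (∀ l, W l 0 = solCoeff ν T u w₀ l) ∧
      ∀ l, IsCoeffFamily T n (W l)) := by
  have h := picardHyp hν hT hu hw₀
  have hadiv : ∀ k, ∑ l, (k l : ℂ) * datumCoeff w₀ l k = 0 := sum_intCast_mul_datumCoeff hw₀ hw₀div
  have ha0 : ∀ l, datumCoeff w₀ l 0 = 0 := datumCoeff_zero hw₀ hw₀mean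
  have hUdiv : ∀ t m, ∑ j, (m j : ℂ) * driftCoeff T u j t m = 0 := sum_intCast_mul_driftCoeff hT.le hu hdiv
  refine ⟨h.continuous_picardLim, h.hasDecay_picardLim, h.sum_intCast_mul_picardLim hadiv,
    h.picardLim_zero_freq ha0 hadiv hUdiv, h.picardLim_zero, fun l k t ht => h.hasDerivWithinAt_picardLim l k ht,
    fun n => ?_⟩
  exact h.exists_coeffFamily (fun n j => isCoeffFamily_driftFam hT hu n j)
    (fun j t ht => driftFam_zero_of_mem u j ht) n

/-! ### The pressure family -/

/-- **The pressure coefficients start a coefficient family of every order.** With `W` the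
velocity families of order `n`, the family `-(2πi|k|²)⁻¹ ∑ₘ kₘ linFamilyₘ` is a family of
order `n` whose zeroth member agrees with `presCoeffField ν T u w₀` on `[0, T]`; replacing the
zeroth member by `presCoeffField ν T u w₀` itself keeps it a family (all clauses of
`IsCoeffFamily` live on `[0, T]`; adapted from `CorrectorFourier.exists_presFamily`). [folklore] -/
theorem exists_presFamily (hT : 0 < T) (hu : IsSmoothSpaceTimeOn (Icc 0 T) u) {n : ℕ}
    {W : d → ℕ → ℝ → (d → ℤ) → ℂ} (hW0 : ∀ l, W l 0 = solCoeff ν T u w₀ l)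
    (hW : ∀ l, IsCoeffFamily T n (W l)) :
    ∃ Q : ℕ → ℝ → (d → ℤ) → ℂ, Q 0 = presCoeffField ν T u w₀ ∧ IsCoeffFamily T n Q := by
  have hUFf : ∀ j, IsCoeffFamily T n (driftFam T u j) := fun j => isCoeffFamily_driftFam hT hu n j
  -- the candidate family
  set Q₀ : ℕ → ℝ → (d → ℤ) → ℂ := fun i t k =>
    (-(1 : ℂ)) / (2 * π * Complex.I * (freqNormSq k : ℂ)) *
      ∑ m, (k m : ℂ) * linFamily (driftFam T u) W m i t k with hQ₀
  have hQ₀f : IsCoeffFamily T n Q₀ :=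
    (IsCoeffFamily.finset_sum _ fun m _ =>
      (IsCoeffFamily.linFamily hT hUFf hW m).symbol (σ := fun k => (k m : ℂ)) (g := 1)
        zero_le_one (norm_intCast_apply_le m)).symbol (g := 0) zero_le_one norm_presSymbol_le
  -- agreement with `presCoeffField` on `[0, T]`
  have hagree : ∀ t ∈ Icc 0 T, ∀ k, Q₀ 0 t k = presCoeffField ν T u w₀ t k := by
    intro t ht k
    simp only [hQ₀, linFamily_zero, presCoeffField_apply, linPresCoef_apply, hW0]
    have hU' : (fun j => driftFam T u j 0 t) = fun j => driftCoeff T u j t :=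
      funext fun j => driftFam_zero_of_mem u j ht
    rw [hU']
    ring
  -- replace the zeroth member
  refine ⟨fun i => if i = 0 then presCoeffField ν T u w₀ else Q₀ i, by simp, ?_⟩
  refine ⟨fun i hi K => ?_, fun i hi m => ?_, fun i hi m t ht => ?_⟩
  · obtain ⟨C, hC⟩ := hQ₀f.decay i hi K
    refine ⟨C, fun t ht m => ?_⟩
    split_ifs with h0
    · subst h0; rw [← hagree t ht m]; exact hC t ht m
    · exact hC t ht m
  · split_ifs with h0
    · subst h0
      exact (hQ₀f.cont 0 hi m).congr fun t ht => (hagree t ht m).symm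
    · exact hQ₀f.cont i hi m
  · have hd := hQ₀f.deriv i hi m t ht
    have hne : i + 1 ≠ 0 := Nat.succ_ne_zero i
    simp only [hne, if_false]
    split_ifs with h0
    · subst h0
      exact hd.congr (fun s hs => (hagree s hs m).symm) (hagree t ht m).symm
    · exact hd

end LinearisedNSFourier

end Literature.Analysis.FluidPDE

end
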